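import Literature.NumberTheory.Automorphic.RankinSelbergContinuationSL2
import Literature.NumberTheory.EllipticCurves.Gamma0EisensteinBound
import HarnessLib

/-!
# Rankin–Selberg on `SL₂(ℤ)\ℍ`, IIb: an a priori bound for `J₀(s) = ∫_𝒟 G E₀*(·, s) dμ` that is
uniform in the horocycle datum

Topic `NumberTheory/Automorphic`; namespace `Literature.NumberTheory.Automorphic`. Proof file
(theorems only; no definition, no named fact), a complement to `RankinSelbergContinuationSL2`
(Rankin 1939, §4.4; Selberg 1940; Zagier 1981, §1). There, for a horocycle datum
`(G, C, a, κ, B)` — a continuous `SL₂(ℤ)`-invariant `0 ≤ G ≤ B` on `ℍ` with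
`∫₀¹ G(x+iy) dx = y^κ Σ Cₙ e^{-any}`, `Cₙ ≥ 0`, `C₀ = 0` — the entire function
`J₀(s) = ∫_𝒟 G E₀*(·, s) dμ` is bounded on vertical strips (`norm_J₀_le`) by the integral of the
majorant `G · (c₁|E(·, 1-σ_a)| + c₂|E(·, σ_b)| + c₃)`, a constant depending on the datum in an
unspecified way. For Siegel-type arguments in the LEVEL aspect (the datum being the `SL₂(ℤ)`-trace
`G_f` of `|f|²y²`, `f ∈ S₂(Γ₀(N))`, with `a = 4π/N`, `EllipticCurves/CuspFormRankinSelbergTrace`) one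
needs this bound to be polynomial in `N` and linear in `∫_𝒟 G_f = (f, f)`. We PROVE, for `κ = 2`:

* `lintegral_strip_indicator_one_lt_im_le` — `∫_{S', Im w > 1} G dμ ≤ ∫_𝒟 G dμ`: unfolding
  (`setLIntegral_fd_mul_tsum_coset`) and the count `Σ_{(c,d)=1} 𝟙[Im γw > 1] ≤ 2` on `𝒟`
  (`tsum_indicator_one_lt_im_le_two`: for `c ≠ 0`, `|cw + d|² ≥ max(1, y²)`);
* `lintegral_strip_indicator_rpow_im_le` — `∫_{S', Im w ≤ 1} G (Im w)ˢ dμ ≤ C_s ∫_𝒟 G dμ`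
  (`1 < s ≤ 2`): the incomplete Eisenstein series `Σ (Im γw)ˢ 𝟙[Im γw ≤ 1]` is bounded on `𝒟`
  (`tsum_indicator_rpow_im_le`, by the lattice-row sums `tsum_int_row_le`,
  `tsum_int_rowBound_le` of `EllipticCurves/Gamma0EisensteinBound`);
* in the coordinates of the strip (`setLIntegral_stripFD_eq`), with `m(y) = ∫₀¹ G(x+iy) dx`:
  `∫_1^∞ m y^{-2} ≤ ∫_𝒟 G`, `∫_0^1 m y^{s-2} ≤ C_s ∫_𝒟 G`, `∫_1^2 m y^{s-2} ≤ 2ˢ ∫_𝒟 G`, and the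
  tail `∫_2^∞ m y^{s-2} ≤ 2(2s/(ea))ˢ ∫_𝒟 G` by trading the weight `yˢ` against one half of the
  exponential decay of the Laplace series (`laplace_le_exp_mul_laplace_half`:
  `L(y) ≤ e^{-ay/2} L(y/2)`, and `yˢe^{-ay/2} ≤ (2s/(ea))ˢ`, `rpow_mul_exp_neg_half_mul_le`) and the substitution `y = 2u`
  (`lintegral_Ioi_comp_half`); altogether `lintegral_Ioi_horocycle_mul_rpow_le`:
  **`∫_0^∞ m(y) y^{s-2} dy ≤ (17 + 4π + 2ˢ + 2(2s/(ea))ˢ) ∫_𝒟 G dμ`** (`s ≥ 3/2`);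
* `lintegral_fd_mul_norm_eisensteinE_eq` — the unfolding of `E(·, σ)` against `G` for real
  `σ > 1` in `ℝ≥0∞` (`∫_𝒟 G |E(·,σ)| dμ = ∫_0^∞ m(y) y^{σ-2} dy`, no integrability hypotheses),
  hence `lintegral_fd_mul_norm_eisensteinE_le`;
* `norm_J₀_le_explicit`, **`exists_norm_J₀_le_uniform`** — there is an ABSOLUTE `Q > 0` with
  `‖J₀(s)‖ ≤ Q (1 + a⁻¹)⁴ ∫_𝒟 G dμ` for every `κ = 2` datum and `-1/2 ≤ Re s ≤ 7/2`
  (the majorant `norm_completedEisenstein₀_le` with `σ_a = -1/2`, `σ_b = 7/2`).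

## References

* R. A. Rankin, Proc. Cambridge Philos. Soc. 35 (1939), 357–372, §4.4. [cite: Rankin1939, §4.4]
* H. Iwaniec, *Spectral Methods of Automorphic Forms*, 2nd ed., GSM 53 (2002), §3.2, (3.20) and
  §7.1 (unfolding; `E(z, s) ≪ y^σ` on `𝒟`). [cite: Iwaniec2002, §3.2]
* D. Zagier, J. Fac. Sci. Univ. Tokyo 28 (1981), 415–437, §1.

## Mathlib / tree search

Tree: `setLIntegral_fd_mul_tsum_coset`, `setLIntegral_stripFD_eq` (`EisensteinOrthogonality`),
`norm_completedEisenstein₀_le`, `integrableOn_fd_majorant`, `norm_J₀_le`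
(`RankinSelbergContinuationSL2`), `tsum_int_row_le`, `tsum_int_rowBound_le`, `rpow_bounds_of_half_le`
(`Gamma0EisensteinBound`), `volume_modular_fd_lt_top`; `lean search 'norm_J₀|incomplete.*Eisenstein.*bound'`.
-/

noncomputable section

open MeasureTheory Set Filter Real UpperHalfPlane Complex
open scoped Topology MatrixGroups NNReal ENNReal

namespace Literature.NumberTheory.Automorphic

open EisensteinSeries

/-! ### Pointwise lemmas on the standard fundamental domain -/

section Pointwise

/-- On `𝒟`: `|cw + d|² ≥ 1` for all integers `c ≠ 0`, `d` (for `|c| ≥ 2`, `c²y² ≥ 4y² ≥ 3`; for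
`|c| = 1`, `|w + d|² ≥ 1` since `|Re w| ≤ 1/2`, `|w| ≥ 1`). [folklore] -/
theorem one_le_normSq_denom_of_mem_fd {w : ℍ} (hw : w ∈ ModularGroup.fd) {c : ℤ} (hc : c ≠ 0)
    (d : ℤ) : 1 ≤ Complex.normSq ((c : ℂ) * w + d) := by
  rw [Literature.NumberTheory.EllipticCurves.ModularForms.normSq_intCast_mul_add]
  have h3 : 3 ≤ 4 * w.im ^ 2 := ModularGroup.three_le_four_mul_im_sq_of_mem_fd hw
  have hre : |w.re| ≤ 1 / 2 := hw.2
  have hnorm : 1 ≤ Complex.normSq (w : ℂ) := hw.1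
  have hc1 : (1 : ℤ) ≤ |c| := Int.one_le_abs hc
  by_cases h2 : 2 ≤ |c|
  · -- `c² y² ≥ 4 y² ≥ 3`
    have h4 : (4 : ℝ) ≤ (c : ℝ) ^ 2 := by
      have : (4 : ℤ) ≤ |c| ^ 2 := by nlinarith
      have : (4 : ℤ) ≤ c ^ 2 := by rwa [sq_abs] at this
      exact_mod_cast this
    nlinarith [sq_nonneg ((c : ℝ) * w.re + d), sq_nonneg w.im]
  · -- `|c| = 1`
    have habs : |c| = 1 := by omega
    have hc2 : (c : ℝ) ^ 2 = 1 := by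
      have : c ^ 2 = 1 := by rw [← sq_abs, habs]; norm_num
      exact_mod_cast this
    by_cases hd : d = 0
    · subst hd
      rw [Complex.normSq_apply] at hnorm
      simp only [UpperHalfPlane.coe_re, UpperHalfPlane.coe_im] at hnorm
      push_cast
      nlinarith [sq_nonneg w.re, sq_nonneg w.im]
    · have hd1 : (1 : ℝ) ≤ |(d : ℝ)| := by
        have : (1 : ℤ) ≤ |d| := Int.one_le_abs hd
        exact_mod_cast this
      -- `|c x + d| ≥ |d| - |c x| ≥ 1 - 1/2`
      have hcx : |(c : ℝ) * w.re| ≤ 1 / 2 := by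
        rw [abs_mul]
        have hca : |(c : ℝ)| = 1 := by
          have : |(c : ℝ)| ^ 2 = 1 := by rw [sq_abs, hc2]
          nlinarith [abs_nonneg (c : ℝ)]
        rw [hca, one_mul]
        exact hre
      have h1 : 1 / 2 ≤ |(c : ℝ) * w.re + d| := by
        have := abs_sub_abs_le_abs_sub ((d : ℝ)) (-((c : ℝ) * w.re))
        rw [abs_neg, sub_neg_eq_add, add_comm] at this
        linarith
      have h2' : 1 / 4 ≤ ((c : ℝ) * w.re + d) ^ 2 := by
        have h0 : (0 : ℝ) ≤ 1 / 2 := by norm_num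
        have := mul_le_mul h1 h1 h0 (abs_nonneg _)
        nlinarith [abs_mul_abs_self ((c : ℝ) * w.re + d)]
      have h3' : 3 / 4 ≤ ((c : ℝ) * w.im) ^ 2 := by
        rw [mul_pow, hc2, one_mul]
        linarith
      linarith

/-- On `𝒟`, a translate by a matrix with `c ≠ 0` has imaginary part `≤ 1`:
`Im γw = y/|cw+d|² ≤ min(y, 1/y)` (`|cw + d|² ≥ max(1, y²)`). [folklore] -/
theorem im_div_normSq_le_one_of_mem_fd {w : ℍ} (hw : w ∈ ModularGroup.fd) {c : ℤ} (hc : c ≠ 0)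
    (d : ℤ) : w.im / Complex.normSq ((c : ℂ) * w + d) ≤ 1 := by
  have hy := w.im_pos
  have h1 := one_le_normSq_denom_of_mem_fd hw hc d
  have hpos : 0 < Complex.normSq ((c : ℂ) * w + d) := by linarith
  rw [div_le_one hpos]
  -- `normSq ≥ c² y² ≥ y²` and `normSq ≥ 1`
  have hc2 : (1 : ℝ) ≤ (c : ℝ) ^ 2 := by
    have : (1 : ℤ) ≤ c ^ 2 := by
      have := Int.one_le_abs hc
      nlinarith [sq_abs c]
    exact_mod_cast this
  have hy2 : w.im ^ 2 ≤ Complex.normSq ((c : ℂ) * w + d) := by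
    rw [Literature.NumberTheory.EllipticCurves.ModularForms.normSq_intCast_mul_add]
    nlinarith [sq_nonneg ((c : ℝ) * w.re + d), sq_nonneg w.im]
  by_cases hy1 : w.im ≤ 1
  · linarith
  · push Not at hy1
    nlinarith

/-- A coprime row with `c = 0` is `(0, ±1)`. [folklore] -/
theorem eq_one_or_eq_neg_one_of_mem_gammaSet {v : Fin 2 → ℤ} (hv : v ∈ gammaSet 1 1 0)
    (h0 : v 0 = 0) : v 1 = 1 ∨ v 1 = -1 := by
  rw [mem_gammaSet_one, h0] at hv
  exact Int.isUnit_iff.mp (isCoprime_zero_left.mp hv)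

end Pointwise

/-! ### Sums over the cosets `Γ_∞ \ SL₂(ℤ)` (coprime rows) -/

section CosetSums

/-- A sum of non-negative terms over the coprime rows is at most the sum over all of `ℤ²`,
written as an iterated sum. [folklore] -/
theorem tsum_gammaSet_le_tsum_int_int (T : (Fin 2 → ℤ) → ℝ≥0∞) :
    ∑' v : gammaSet 1 1 0, T v ≤ ∑' c : ℤ, ∑' d : ℤ, T ![c, d] := by
  have h1 : ∑' v : gammaSet 1 1 0, T v ≤ ∑' p : Fin 2 → ℤ, T p :=
    ENNReal.tsum_comp_le_tsum_of_injective Subtype.coe_injective T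
  refine h1.trans (le_of_eq ?_)
  rw [← (piFinTwoEquiv fun _ : Fin 2 ↦ ℤ).symm.tsum_eq, ENNReal.tsum_prod']
  exact tsum_congr fun c ↦ tsum_congr fun d ↦ rfl

/-- `#{d ∈ ℤ : d = ±1} = 2`, as a `tsum`. [folklore] -/
theorem tsum_int_ite_eq_one_or_neg_one :
    ∑' d : ℤ, (if d = 1 ∨ d = -1 then (1 : ℝ≥0∞) else 0) = 2 := by
  rw [tsum_eq_sum (s := ({1, -1} : Finset ℤ))]
  · rw [Finset.sum_pair (by norm_num)]
    norm_num
  · intro d hd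
    simp only [Finset.mem_insert, Finset.mem_singleton, not_or] at hd
    exact if_neg (not_or.mpr hd)

/-- **At most the two rows `(0, ±1)` move a point of `𝒟` above height `1`**:
`Σ_{(c,d)=1} 𝟙[Im γ_{c,d} w > 1] ≤ 2` for `w ∈ 𝒟`. [folklore] -/
theorem tsum_indicator_one_lt_im_le_two {w : ℍ} (hw : w ∈ ModularGroup.fd) :
    ∑' v : gammaSet 1 1 0, {z : ℍ | 1 < z.im}.indicator (fun _ ↦ (1 : ℝ≥0∞)) (rowRep v • w) ≤ 2 := by
  set T : (Fin 2 → ℤ) → ℝ≥0∞ := fun p ↦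
    if p 0 = 0 then (if p 1 = 1 ∨ p 1 = -1 then 1 else 0) else 0 with hT
  have hle : ∀ v : gammaSet 1 1 0,
      {z : ℍ | 1 < z.im}.indicator (fun _ ↦ (1 : ℝ≥0∞)) (rowRep v • w) ≤ T v := by
    intro v
    by_cases h0 : (v : Fin 2 → ℤ) 0 = 0
    · have h1 := eq_one_or_eq_neg_one_of_mem_gammaSet v.2 h0
      simp only [hT, if_pos h0, if_pos h1]
      exact Set.indicator_apply_le' (fun _ ↦ le_rfl) (fun _ ↦ bot_le)
    · simp only [hT, if_neg h0]
      refine Set.indicator_apply_le' (fun hz ↦ ?_) (fun _ ↦ le_rfl)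
      exfalso
      simp only [Set.mem_setOf_eq] at hz
      rw [im_rowRep_smul_eq] at hz
      exact (im_div_normSq_le_one_of_mem_fd hw h0 _).not_gt hz
  calc ∑' v : gammaSet 1 1 0, {z : ℍ | 1 < z.im}.indicator (fun _ ↦ (1 : ℝ≥0∞)) (rowRep v • w)
      ≤ ∑' v : gammaSet 1 1 0, T v := ENNReal.tsum_le_tsum hle
    _ ≤ ∑' c : ℤ, ∑' d : ℤ, T ![c, d] := tsum_gammaSet_le_tsum_int_int T
    _ = ∑' c : ℤ, (if c = 0 then 2 else 0) := by
        refine tsum_congr fun c ↦ ?_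
        by_cases hc : c = 0
        · subst hc
          rw [if_pos rfl]
          simp only [hT, Matrix.cons_val_zero, Matrix.cons_val_one, if_true]
          exact tsum_int_ite_eq_one_or_neg_one
        · rw [if_neg hc]
          simp [hT, hc]
    _ = 2 := tsum_ite_eq 0 2

/-- **The incomplete Eisenstein series of height `≤ 1` is bounded on `𝒟`**:
`Σ_{(c,d)=1} (Im γw)ˢ 𝟙[Im γw ≤ 1] ≤ 2 + 32 + 4π(1 + 1/(2(s−1)))` for `w ∈ 𝒟`, `1 < s ≤ 2` (the two
rows `c = 0` give at most `1` each; the rows `c ≠ 0` give `≤ 8y^{-s} + 2πy^{1-s}(1 + 1/(2(s−1)))`,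
`EllipticCurves.ModularForms.tsum_int_rowBound_le`, and `y ≥ 1/2`). [folklore] -/
theorem tsum_indicator_rpow_im_le {w : ℍ} (hw : w ∈ ModularGroup.fd) {s : ℝ} (hs1 : 1 < s)
    (hs2 : s ≤ 2) :
    ∑' v : gammaSet 1 1 0,
        {z : ℍ | z.im ≤ 1}.indicator (fun z ↦ ENNReal.ofReal (z.im ^ s)) (rowRep v • w) ≤
      2 + ENNReal.ofReal (32 + 4 * π * (1 + 1 / (2 * (s - 1)))) := by
  have hy := w.im_pos
  set T : (Fin 2 → ℤ) → ℝ≥0∞ := fun p ↦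
    if p 0 = 0 then (if p 1 = 1 ∨ p 1 = -1 then 1 else 0)
    else ENNReal.ofReal ((w.im / Complex.normSq ((p 0 : ℂ) * w + p 1)) ^ s) with hT
  have hle : ∀ v : gammaSet 1 1 0,
      {z : ℍ | z.im ≤ 1}.indicator (fun z ↦ ENNReal.ofReal (z.im ^ s)) (rowRep v • w) ≤ T v := by
    intro v
    by_cases h0 : (v : Fin 2 → ℤ) 0 = 0
    · have h1 := eq_one_or_eq_neg_one_of_mem_gammaSet v.2 h0
      simp only [hT, if_pos h0, if_pos h1]
      refine Set.indicator_apply_le' (fun hz ↦ ?_) (fun _ ↦ bot_le)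
      simp only [Set.mem_setOf_eq] at hz
      exact ENNReal.ofReal_le_one.mpr (Real.rpow_le_one (UpperHalfPlane.im_pos _).le hz (by linarith))
    · simp only [hT, if_neg h0]
      refine Set.indicator_apply_le' (fun _ ↦ ?_) (fun _ ↦ bot_le)
      rw [im_rowRep_smul_eq]
  have hrow : ∀ c : ℤ, ∑' d : ℤ, T ![c, d] ≤ (if c = 0 then 2 else
      ENNReal.ofReal (w.im ^ s * (2 * (|(c : ℝ)| * w.im) ^ (-(2 * s)) +
        π * (|(c : ℝ)| * w.im) ^ (1 - 2 * s)))) := by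
    intro c
    by_cases hc : c = 0
    · subst hc
      rw [if_pos rfl]
      simp only [hT, Matrix.cons_val_zero, Matrix.cons_val_one, if_true]
      exact le_of_eq tsum_int_ite_eq_one_or_neg_one
    · rw [if_neg hc]
      simp only [hT, Matrix.cons_val_zero, Matrix.cons_val_one, if_neg hc]
      exact Literature.NumberTheory.EllipticCurves.ModularForms.tsum_int_row_le w hs1.le hc
  have hy2 : 1 / 2 ≤ w.im := half_le_im_of_mem_fd hw
  obtain ⟨-, hb1, hb2⟩ :=
    Literature.NumberTheory.EllipticCurves.ModularForms.rpow_bounds_of_half_le hy2 hs1 hs2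
  have hs0 : 0 < s - 1 := by linarith
  calc ∑' v : gammaSet 1 1 0,
        {z : ℍ | z.im ≤ 1}.indicator (fun z ↦ ENNReal.ofReal (z.im ^ s)) (rowRep v • w)
      ≤ ∑' v : gammaSet 1 1 0, T v := ENNReal.tsum_le_tsum hle
    _ ≤ ∑' c : ℤ, ∑' d : ℤ, T ![c, d] := tsum_gammaSet_le_tsum_int_int T
    _ ≤ ∑' c : ℤ, (if c = 0 then 2 else
          ENNReal.ofReal (w.im ^ s * (2 * (|(c : ℝ)| * w.im) ^ (-(2 * s)) +
            π * (|(c : ℝ)| * w.im) ^ (1 - 2 * s)))) := ENNReal.tsum_le_tsum hrow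
    _ = 2 + ∑' c : ℤ, (if c = 0 then 0 else
          ENNReal.ofReal (w.im ^ s * (2 * (|(c : ℝ)| * w.im) ^ (-(2 * s)) +
            π * (|(c : ℝ)| * w.im) ^ (1 - 2 * s)))) := by
        rw [ENNReal.tsum_eq_add_tsum_ite (0 : ℤ), if_pos rfl]
        congr 1
        refine tsum_congr fun c ↦ ?_
        by_cases hc : c = 0 <;> simp [hc]
    _ ≤ 2 + ENNReal.ofReal (8 * w.im ^ (-s) + 2 * π * w.im ^ (1 - s) * (1 + 1 / (2 * (s - 1)))) := by
        gcongr
        exact Literature.NumberTheory.EllipticCurves.ModularForms.tsum_int_rowBound_le w hs1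
    _ ≤ 2 + ENNReal.ofReal (32 + 4 * π * (1 + 1 / (2 * (s - 1)))) := by
        gcongr 2 + ENNReal.ofReal ?_
        have h1 : 8 * w.im ^ (-s) ≤ 32 := by linarith
        have h2 : 2 * π * w.im ^ (1 - s) * (1 + 1 / (2 * (s - 1))) ≤
            4 * π * (1 + 1 / (2 * (s - 1))) := by
          have hπ := Real.pi_pos
          have hf : 0 ≤ 1 + 1 / (2 * (s - 1)) := by positivity
          calc 2 * π * w.im ^ (1 - s) * (1 + 1 / (2 * (s - 1)))
              ≤ 2 * π * 2 * (1 + 1 / (2 * (s - 1))) := by gcongr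
            _ = 4 * π * (1 + 1 / (2 * (s - 1))) := by ring
        linarith

end CosetSums

/-! ### Unfolding inequalities for an invariant non-negative function on the strip -/

section Strip

variable {G : ℍ → ℝ}

/-- Measurability of `w ↦ ofReal (G w)` for continuous `G`. [folklore] -/
theorem measurable_ofReal_comp (hGc : Continuous G) :
    Measurable fun w : ℍ ↦ ENNReal.ofReal (G w) :=
  ENNReal.measurable_ofReal.comp hGc.measurable

/-- `SL₂(ℤ)`-invariance of `G` in the form used by `setLIntegral_fd_mul_tsum_coset`. [folklore] -/
theorem ofReal_comp_smul_eq (hGinv : ∀ (A : SL(2, ℤ)) (τ : ℍ), G (A • τ) = G τ) :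
    ∀ γ ∈ (𝒮ℒ : Subgroup (GL (Fin 2) ℝ)), ∀ w : ℍ,
      ENNReal.ofReal (G (γ • w)) = ENNReal.ofReal (G w) := by
  rintro γ ⟨A, rfl⟩ w
  rw [show (Matrix.SpecialLinearGroup.mapGL ℝ A : GL (Fin 2) ℝ) • w = A • w from rfl, hGinv]

/-- **The part of the strip above height `1` carries at most the mass of one fundamental
domain**: `∫_{S', Im w > 1} G dμ ≤ ∫_𝒟 G dμ` for `G ≥ 0` continuous and `SL₂(ℤ)`-invariant
(unfolding, and `tsum_indicator_one_lt_im_le_two`). [folklore] -/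
theorem lintegral_strip_indicator_one_lt_im_le (hGc : Continuous G)
    (hGinv : ∀ (A : SL(2, ℤ)) (τ : ℍ), G (A • τ) = G τ) :
    ∫⁻ w in stripFD, {z : ℍ | 1 < z.im}.indicator (fun _ ↦ (1 : ℝ≥0∞)) w * ENNReal.ofReal (G w) ≤
      ∫⁻ w in ModularGroup.fd, ENNReal.ofReal (G w) := by
  set Ψ : ℍ → ℝ≥0∞ := {z : ℍ | 1 < z.im}.indicator (fun _ ↦ (1 : ℝ≥0∞)) with hΨdef
  have hΦm := measurable_ofReal_comp hGc
  have hΨm : Measurable Ψ :=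
    measurable_const.indicator (measurableSet_lt measurable_const UpperHalfPlane.continuous_im.measurable)
  have hΨ : ∀ (n : ℤ) (w : ℍ), Ψ ((n : ℝ) +ᵥ w) = Ψ w := by
    intro n w
    by_cases h1 : 1 < w.im
    · rw [hΨdef, Set.indicator_of_mem (show (n : ℝ) +ᵥ w ∈ {z : ℍ | 1 < z.im} by
        simpa [UpperHalfPlane.vadd_im] using h1), Set.indicator_of_mem (show w ∈ {z : ℍ | 1 < z.im} from h1)]
    · rw [hΨdef, Set.indicator_of_notMem (show (n : ℝ) +ᵥ w ∉ {z : ℍ | 1 < z.im} by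
        simpa [UpperHalfPlane.vadd_im] using h1), Set.indicator_of_notMem (show w ∉ {z : ℍ | 1 < z.im} from h1)]
  have h := setLIntegral_fd_mul_tsum_coset hΦm hΨm (ofReal_comp_smul_eq hGinv) hΨ
  have hle : ∫⁻ w in ModularGroup.fd, ENNReal.ofReal (G w) * ∑' v : gammaSet 1 1 0, Ψ (rowRep v • w) ≤
      ∫⁻ w in ModularGroup.fd, ENNReal.ofReal (G w) * 2 := by
    refine setLIntegral_mono' ModularGroup.isClosed_fd.measurableSet fun w hw ↦ ?_
    gcongr
    exact tsum_indicator_one_lt_im_le_two hw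
  rw [h, lintegral_mul_const _ hΦm, mul_comm _ (2 : ℝ≥0∞)] at hle
  exact (ENNReal.mul_le_mul_iff_right two_ne_zero ENNReal.ofNat_ne_top).mp hle

/-- **The part of the strip of height `≤ 1`, weighted by `(Im w)ˢ`, carries at most a bounded
multiple of the mass of one fundamental domain**:
`∫_{S', Im w ≤ 1} G (Im w)ˢ dμ ≤ (1 + 16 + 2π(1 + 1/(2(s−1)))) ∫_𝒟 G dμ` (`1 < s ≤ 2`; unfolding, and the
bound `tsum_indicator_rpow_im_le` for the incomplete Eisenstein series on `𝒟`). [folklore] -/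
theorem lintegral_strip_indicator_rpow_im_le (hGc : Continuous G)
    (hGinv : ∀ (A : SL(2, ℤ)) (τ : ℍ), G (A • τ) = G τ) {s : ℝ} (hs1 : 1 < s) (hs2 : s ≤ 2) :
    ∫⁻ w in stripFD, {z : ℍ | z.im ≤ 1}.indicator (fun z ↦ ENNReal.ofReal (z.im ^ s)) w *
        ENNReal.ofReal (G w) ≤
      (1 + ENNReal.ofReal (16 + 2 * π * (1 + 1 / (2 * (s - 1))))) *
        ∫⁻ w in ModularGroup.fd, ENNReal.ofReal (G w) := by
  set Ψ : ℍ → ℝ≥0∞ := {z : ℍ | z.im ≤ 1}.indicator (fun z ↦ ENNReal.ofReal (z.im ^ s)) with hΨdef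
  set K : ℝ≥0∞ := 1 + ENNReal.ofReal (16 + 2 * π * (1 + 1 / (2 * (s - 1)))) with hK
  have hΦm := measurable_ofReal_comp hGc
  have hΨm : Measurable Ψ :=
    (ENNReal.measurable_ofReal.comp (UpperHalfPlane.continuous_im.measurable.pow_const s)).indicator
      (measurableSet_le UpperHalfPlane.continuous_im.measurable measurable_const)
  have hΨ : ∀ (n : ℤ) (w : ℍ), Ψ ((n : ℝ) +ᵥ w) = Ψ w := by
    intro n w
    by_cases h1 : w.im ≤ 1
    · rw [hΨdef, Set.indicator_of_mem (show (n : ℝ) +ᵥ w ∈ {z : ℍ | z.im ≤ 1} by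
        simpa [UpperHalfPlane.vadd_im] using h1), Set.indicator_of_mem (show w ∈ {z : ℍ | z.im ≤ 1} from h1),
        UpperHalfPlane.vadd_im]
    · rw [hΨdef, Set.indicator_of_notMem (show (n : ℝ) +ᵥ w ∉ {z : ℍ | z.im ≤ 1} by
        simpa [UpperHalfPlane.vadd_im] using h1), Set.indicator_of_notMem (show w ∉ {z : ℍ | z.im ≤ 1} from h1)]
  have h := setLIntegral_fd_mul_tsum_coset hΦm hΨm (ofReal_comp_smul_eq hGinv) hΨ
  have hs0 : 0 < s - 1 := by linarith
  have hK2 : (2 : ℝ≥0∞) + ENNReal.ofReal (32 + 4 * π * (1 + 1 / (2 * (s - 1)))) = 2 * K := by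
    have hreal : (32 + 4 * π * (1 + 1 / (2 * (s - 1)))) = 2 * (16 + 2 * π * (1 + 1 / (2 * (s - 1)))) := by
      ring
    rw [hK, hreal, ENNReal.ofReal_mul (by norm_num : (0 : ℝ) ≤ 2), ENNReal.ofReal_ofNat]
    ring
  have hle : ∫⁻ w in ModularGroup.fd, ENNReal.ofReal (G w) * ∑' v : gammaSet 1 1 0, Ψ (rowRep v • w) ≤
      ∫⁻ w in ModularGroup.fd, ENNReal.ofReal (G w) * (2 * K) := by
    refine setLIntegral_mono' ModularGroup.isClosed_fd.measurableSet fun w hw ↦ ?_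
    gcongr
    rw [← hK2]
    exact tsum_indicator_rpow_im_le hw hs1 hs2
  rw [h, lintegral_mul_const _ hΦm, mul_comm _ (2 * K), mul_assoc] at hle
  exact (ENNReal.mul_le_mul_iff_right two_ne_zero ENNReal.ofNat_ne_top).mp hle

/-! ### The same inequalities in the coordinates `(x, y)` of the strip -/

/-- The horocycle average as a Lebesgue integral. [folklore] -/
theorem lintegral_Ico_ofReal_eq (hGc : Continuous G) (hG0 : ∀ τ, 0 ≤ G τ) {y : ℝ} (hy : 0 < y) :
    ∫⁻ x in Ico (0 : ℝ) 1, ENNReal.ofReal (G (pt x y)) =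
      ENNReal.ofReal (∫ x in (0 : ℝ)..1, G (pt x y)) := by
  have hGi : IntegrableOn (fun x : ℝ ↦ G (pt x y)) (Ico 0 1) :=
    ((hGc.comp (continuous_pt hy)).integrableOn_Icc).mono_set Ico_subset_Icc_self
  rw [← ofReal_integral_eq_lintegral_ofReal hGi (ae_of_all _ fun x ↦ hG0 _),
    integral_Ico_eq_integral_Ioc, ← intervalIntegral.integral_of_le zero_le_one]

/-- A set integral over `Ioi 0` of a function supported in `T ⊆ Ioi 0`. [folklore] -/
theorem setLIntegral_Ioi_indicator {T : Set ℝ} (hT : MeasurableSet T) (hT0 : T ⊆ Ioi 0)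
    (f : ℝ → ℝ≥0∞) : ∫⁻ y in Ioi (0 : ℝ), T.indicator f y = ∫⁻ y in T, f y := by
  rw [lintegral_indicator hT, Measure.restrict_restrict hT, Set.inter_eq_self_of_subset_left hT0]

/-- **`∫_1^∞ m(y) y^{-2} dy ≤ ∫_𝒟 G dμ`**, `m(y) = ∫₀¹ G(x + iy) dx` (the strip above height `1`,
`lintegral_strip_indicator_one_lt_im_le`, in coordinates). [folklore] -/
theorem lintegral_Ioi_one_horocycle_le (hGc : Continuous G)
    (hGinv : ∀ (A : SL(2, ℤ)) (τ : ℍ), G (A • τ) = G τ) (hG0 : ∀ τ, 0 ≤ G τ) :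
    ∫⁻ y in Ioi (1 : ℝ), ENNReal.ofReal ((∫ x in (0 : ℝ)..1, G (pt x y)) * (y ^ 2)⁻¹) ≤
      ∫⁻ w in ModularGroup.fd, ENNReal.ofReal (G w) := by
  have h := lintegral_strip_indicator_one_lt_im_le hGc hGinv
  set Fi : ℍ → ℝ≥0∞ := fun w ↦ {z : ℍ | 1 < z.im}.indicator (fun _ ↦ (1 : ℝ≥0∞)) w *
    ENNReal.ofReal (G w) with hFi
  have hFm : Measurable Fi :=
    (measurable_const.indicator (measurableSet_lt measurable_const
      UpperHalfPlane.continuous_im.measurable)).mul (measurable_ofReal_comp hGc)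
  have hco := setLIntegral_stripFD_eq Fi hFm
  change ∫⁻ w in stripFD, Fi w ≤ _ at h
  rw [hco] at h
  refine le_trans (le_of_eq ?_) h
  have hg : ∀ y ∈ Ioi (0 : ℝ), (∫⁻ x in Ico (0 : ℝ) 1, Fi (pt x y)) * ENNReal.ofReal ((y ^ 2)⁻¹) =
      (Ioi (1 : ℝ)).indicator
        (fun y ↦ ENNReal.ofReal ((∫ x in (0 : ℝ)..1, G (pt x y)) * (y ^ 2)⁻¹)) y := by
    intro y hy
    have hy0 : (0 : ℝ) < y := hy
    by_cases h1 : 1 < y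
    · rw [Set.indicator_of_mem (show y ∈ Ioi (1 : ℝ) from h1)]
      have hin : ∀ x : ℝ, Fi (pt x y) = ENNReal.ofReal (G (pt x y)) := by
        intro x
        simp only [hFi]
        rw [Set.indicator_of_mem (by simp [pt_im hy0, h1]), one_mul]
      simp_rw [hin]
      rw [lintegral_Ico_ofReal_eq hGc hG0 hy0, ← ENNReal.ofReal_mul (horocycleAverage_nonneg hG0 y)]
    · rw [Set.indicator_of_notMem (show y ∉ Ioi (1 : ℝ) from h1)]
      have hin : ∀ x : ℝ, Fi (pt x y) = 0 := by
        intro x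
        simp only [hFi]
        rw [Set.indicator_of_notMem (by simp [pt_im hy0, h1]), zero_mul]
      simp_rw [hin]
      rw [lintegral_zero, zero_mul]
  rw [setLIntegral_congr_fun measurableSet_Ioi hg,
    setLIntegral_Ioi_indicator measurableSet_Ioi (Ioi_subset_Ioi zero_le_one)]

/-- **`∫_0^1 m(y) y^{s-2} dy ≤ (17 + 2π(1 + 1/(2(s−1)))) ∫_𝒟 G dμ`** for `1 < s ≤ 2` (the strip of
height `≤ 1`, `lintegral_strip_indicator_rpow_im_le`, in coordinates). [folklore] -/
theorem lintegral_Ioc_zero_one_horocycle_le (hGc : Continuous G)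
    (hGinv : ∀ (A : SL(2, ℤ)) (τ : ℍ), G (A • τ) = G τ) (hG0 : ∀ τ, 0 ≤ G τ) {s : ℝ}
    (hs1 : 1 < s) (hs2 : s ≤ 2) :
    ∫⁻ y in Ioc (0 : ℝ) 1, ENNReal.ofReal ((∫ x in (0 : ℝ)..1, G (pt x y)) * y ^ (s - 2)) ≤
      (1 + ENNReal.ofReal (16 + 2 * π * (1 + 1 / (2 * (s - 1))))) *
        ∫⁻ w in ModularGroup.fd, ENNReal.ofReal (G w) := by
  have h := lintegral_strip_indicator_rpow_im_le hGc hGinv hs1 hs2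
  set Fi : ℍ → ℝ≥0∞ := fun w ↦ {z : ℍ | z.im ≤ 1}.indicator (fun z ↦ ENNReal.ofReal (z.im ^ s)) w *
    ENNReal.ofReal (G w) with hFi
  have hFm : Measurable Fi :=
    ((ENNReal.measurable_ofReal.comp (UpperHalfPlane.continuous_im.measurable.pow_const s)).indicator
      (measurableSet_le UpperHalfPlane.continuous_im.measurable measurable_const)).mul
      (measurable_ofReal_comp hGc)
  have hco := setLIntegral_stripFD_eq Fi hFm
  change ∫⁻ w in stripFD, Fi w ≤ _ at h
  rw [hco] at h
  refine le_trans (le_of_eq ?_) h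
  have hg : ∀ y ∈ Ioi (0 : ℝ), (∫⁻ x in Ico (0 : ℝ) 1, Fi (pt x y)) * ENNReal.ofReal ((y ^ 2)⁻¹) =
      (Ioc (0 : ℝ) 1).indicator
        (fun y ↦ ENNReal.ofReal ((∫ x in (0 : ℝ)..1, G (pt x y)) * y ^ (s - 2))) y := by
    intro y hy
    have hy0 : (0 : ℝ) < y := hy
    by_cases h1 : y ≤ 1
    · rw [Set.indicator_of_mem (show y ∈ Ioc (0 : ℝ) 1 from ⟨hy0, h1⟩)]
      have hin : ∀ x : ℝ, Fi (pt x y) = ENNReal.ofReal (y ^ s) * ENNReal.ofReal (G (pt x y)) := by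
        intro x
        simp only [hFi]
        rw [Set.indicator_of_mem (by simp [pt_im hy0, h1]), pt_im hy0]
      simp_rw [hin]
      have hmx : Measurable (fun x : ℝ ↦ ENNReal.ofReal (G (pt x y))) :=
        (measurable_ofReal_comp hGc).comp (continuous_pt hy0).measurable
      rw [lintegral_const_mul _ hmx, lintegral_Ico_ofReal_eq hGc hG0 hy0, ← ENNReal.ofReal_mul (Real.rpow_nonneg hy0.le _),
        ← ENNReal.ofReal_mul (mul_nonneg (Real.rpow_nonneg hy0.le _) (horocycleAverage_nonneg hG0 y))]
      congr 1
      have : y ^ (s - 2) = y ^ s * (y ^ 2)⁻¹ := by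
        rw [Real.rpow_sub hy0, Real.rpow_two, div_eq_mul_inv]
      rw [this]
      ring
    · rw [Set.indicator_of_notMem (show y ∉ Ioc (0 : ℝ) 1 from fun hh ↦ h1 hh.2)]
      have hin : ∀ x : ℝ, Fi (pt x y) = 0 := by
        intro x
        simp only [hFi]
        rw [Set.indicator_of_notMem (by simp [pt_im hy0, h1]), zero_mul]
      simp_rw [hin]
      rw [lintegral_zero, zero_mul]
  rw [setLIntegral_congr_fun measurableSet_Ioi hg,
    setLIntegral_Ioi_indicator measurableSet_Ioc (fun y hy ↦ hy.1)]

/-- **`∫_1^2 m(y) y^{s-2} dy ≤ 2ˢ ∫_𝒟 G dμ`** for `s ≥ 0`. [folklore] -/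
theorem lintegral_Ioc_one_two_horocycle_le (hGc : Continuous G)
    (hGinv : ∀ (A : SL(2, ℤ)) (τ : ℍ), G (A • τ) = G τ) (hG0 : ∀ τ, 0 ≤ G τ) {s : ℝ} (hs : 0 ≤ s) :
    ∫⁻ y in Ioc (1 : ℝ) 2, ENNReal.ofReal ((∫ x in (0 : ℝ)..1, G (pt x y)) * y ^ (s - 2)) ≤
      ENNReal.ofReal (2 ^ s) * ∫⁻ w in ModularGroup.fd, ENNReal.ofReal (G w) := by
  have h1 : ∫⁻ y in Ioc (1 : ℝ) 2, ENNReal.ofReal ((∫ x in (0 : ℝ)..1, G (pt x y)) * y ^ (s - 2)) ≤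
      ∫⁻ y in Ioc (1 : ℝ) 2, ENNReal.ofReal (2 ^ s) *
        ENNReal.ofReal ((∫ x in (0 : ℝ)..1, G (pt x y)) * (y ^ 2)⁻¹) := by
    refine setLIntegral_mono' measurableSet_Ioc fun y hy ↦ ?_
    have hy0 : 0 < y := by linarith [hy.1]
    rw [← ENNReal.ofReal_mul (by positivity)]
    refine ENNReal.ofReal_le_ofReal ?_
    have hm := horocycleAverage_nonneg hG0 y
    have hys : y ^ s ≤ 2 ^ s := Real.rpow_le_rpow hy0.le hy.2 hs
    have : y ^ (s - 2) = y ^ s * (y ^ 2)⁻¹ := by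
      rw [Real.rpow_sub hy0, Real.rpow_two, div_eq_mul_inv]
    rw [this]
    calc (∫ x in (0 : ℝ)..1, G (pt x y)) * (y ^ s * (y ^ 2)⁻¹)
        = y ^ s * ((∫ x in (0 : ℝ)..1, G (pt x y)) * (y ^ 2)⁻¹) := by ring
      _ ≤ 2 ^ s * ((∫ x in (0 : ℝ)..1, G (pt x y)) * (y ^ 2)⁻¹) := by
          gcongr
  refine h1.trans ?_
  rw [lintegral_const_mul' _ _ ENNReal.ofReal_ne_top]
  gcongr
  exact (lintegral_mono_set Ioc_subset_Ioi_self).trans (lintegral_Ioi_one_horocycle_le hGc hGinv hG0)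

end Strip

/-! ### The tail `y ≥ 2`: trading polynomial growth against the Laplace series -/

section Tail

variable {G : ℍ → ℝ} {C : ℕ → ℝ} {a : ℝ}

/-- `yˢ e^{-ay/2} ≤ (2s/(ea))ˢ` for `y, s, a > 0` (the maximum of `yˢe^{-by}`, `b = a/2`, is at
`y = s/b`; from `log u ≤ u − 1` with `u = by/s`). [folklore] -/
theorem rpow_mul_exp_neg_half_mul_le {s a y : ℝ} (hs : 0 < s) (ha : 0 < a) (hy : 0 < y) :
    y ^ s * Real.exp (-(a / 2 * y)) ≤ (2 * s / (Real.exp 1 * a)) ^ s := by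
  set b : ℝ := a / 2 with hb
  have hb0 : 0 < b := by positivity
  have hu : 0 < b * y / s := by positivity
  have hlog := Real.log_le_sub_one_of_pos hu
  rw [Real.log_div (by positivity) hs.ne', Real.log_mul hb0.ne' hy.ne'] at hlog
  have hq : 0 < s / (Real.exp 1 * b) := by positivity
  have e2 : 2 * s / (Real.exp 1 * a) = s / (Real.exp 1 * b) := by
    rw [hb]; field_simp
  rw [e2, Real.rpow_def_of_pos hy, Real.rpow_def_of_pos hq, ← Real.exp_add, Real.exp_le_exp,
    Real.log_div hs.ne' (by positivity), Real.log_mul (Real.exp_pos 1).ne' hb0.ne', Real.log_exp]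
  have h1 := mul_le_mul_of_nonneg_left hlog hs.le
  have e : s * (b * y / s - 1) = b * y - s := by field_simp
  rw [e] at h1
  nlinarith

/-- **Halving the height in the Laplace series**: `L(y) ≤ e^{-ay/2} L(y/2)` for
`L(y) = Σ_{n ≥ 1} Cₙ e^{-a n y}`, `Cₙ ≥ 0` (termwise, `e^{-any} = e^{-any/2} e^{-any/2} ≤ e^{-ay/2} e^{-an(y/2)}`
for `n ≥ 1`). [folklore] -/
theorem laplace_le_exp_mul_laplace_half (hC : ∀ n, 0 ≤ C n) (hC0 : C 0 = 0) (ha : 0 < a)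
    (hs : ∀ y : ℝ, 0 < y → Summable fun n : ℕ ↦ C n * Real.exp (-a * n * y)) {y : ℝ}
    (hy : 0 < y) :
    ∑' n : ℕ, C n * Real.exp (-a * n * y) ≤
      Real.exp (-(a / 2 * y)) * ∑' n : ℕ, C n * Real.exp (-a * n * (y / 2)) := by
  rw [← tsum_mul_left]
  refine (hs y hy).tsum_le_tsum (fun n ↦ ?_) ((hs (y / 2) (by positivity)).mul_left _)
  rcases Nat.eq_zero_or_pos n with rfl | hn
  · simp [hC0]
  · have h1 : (1 : ℝ) ≤ n := by exact_mod_cast hn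
    have key : Real.exp (-a * n * y) ≤ Real.exp (-(a / 2 * y)) * Real.exp (-a * n * (y / 2)) := by
      rw [← Real.exp_add, Real.exp_le_exp]
      nlinarith [mul_pos ha hy]
    calc C n * Real.exp (-a * n * y)
        ≤ C n * (Real.exp (-(a / 2 * y)) * Real.exp (-a * n * (y / 2))) :=
          mul_le_mul_of_nonneg_left key (hC n)
      _ = Real.exp (-(a / 2 * y)) * (C n * Real.exp (-a * n * (y / 2))) := by ring

/-- **Pointwise tail estimate**: for a `κ = 2` horocycle datum, `m(y) = y² L(y)`, and `s > 0`,
`m(y) y^{s-2} = L(y) yˢ ≤ e^{-ay/2} yˢ L(y/2) ≤ 4 (2s/(ea))ˢ · m(y/2) y^{-2}`. [folklore] -/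
theorem horocycle_mul_rpow_le_tail (hC : ∀ n, 0 ≤ C n) (hC0 : C 0 = 0) (ha : 0 < a)
    (hs : ∀ y : ℝ, 0 < y → Summable fun n : ℕ ↦ C n * Real.exp (-a * n * y))
    (hm : ∀ y : ℝ, 0 < y → ∫ x in (0 : ℝ)..1, G (pt x y) =
      y ^ (2 : ℝ) * ∑' n : ℕ, C n * Real.exp (-a * n * y))
    {s : ℝ} (hs0 : 0 < s) {y : ℝ} (hy : 0 < y) :
    (∫ x in (0 : ℝ)..1, G (pt x y)) * y ^ (s - 2) ≤
      4 * (2 * s / (Real.exp 1 * a)) ^ s * ((∫ x in (0 : ℝ)..1, G (pt x (y / 2))) * (y ^ 2)⁻¹) := by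
  set L : ℝ → ℝ := fun y ↦ ∑' n : ℕ, C n * Real.exp (-a * n * y) with hL
  have hL0 : ∀ y, 0 ≤ L y := fun y ↦ tsum_nonneg fun n ↦ mul_nonneg (hC n) (Real.exp_pos _).le
  have hy2 : 0 < y / 2 := by positivity
  rw [hm y hy, hm (y / 2) hy2]
  change y ^ (2 : ℝ) * L y * y ^ (s - 2) ≤
    4 * (2 * s / (Real.exp 1 * a)) ^ s * ((y / 2) ^ (2 : ℝ) * L (y / 2) * (y ^ 2)⁻¹)
  have e1 : y ^ (2 : ℝ) * L y * y ^ (s - 2) = L y * y ^ s := by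
    have : y ^ (2 : ℝ) * y ^ (s - 2) = y ^ s := by
      rw [← Real.rpow_add hy]; ring_nf
    calc y ^ (2 : ℝ) * L y * y ^ (s - 2) = L y * (y ^ (2 : ℝ) * y ^ (s - 2)) := by ring
      _ = L y * y ^ s := by rw [this]
  have e2 : (y / 2) ^ (2 : ℝ) * L (y / 2) * (y ^ 2)⁻¹ = L (y / 2) / 4 := by
    rw [Real.rpow_two]
    field_simp
    ring
  rw [e1, e2]
  have hlap : L y ≤ Real.exp (-(a / 2 * y)) * L (y / 2) :=
    laplace_le_exp_mul_laplace_half hC hC0 ha hs hy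
  have hM := rpow_mul_exp_neg_half_mul_le hs0 ha hy
  have hys : 0 ≤ y ^ s := Real.rpow_nonneg hy.le _
  calc L y * y ^ s ≤ Real.exp (-(a / 2 * y)) * L (y / 2) * y ^ s :=
        mul_le_mul_of_nonneg_right hlap hys
    _ = (y ^ s * Real.exp (-(a / 2 * y))) * L (y / 2) := by ring
    _ ≤ (2 * s / (Real.exp 1 * a)) ^ s * L (y / 2) := mul_le_mul_of_nonneg_right hM (hL0 _)
    _ = 4 * (2 * s / (Real.exp 1 * a)) ^ s * (L (y / 2) / 4) := by ring

/-- The substitution `y = 2u` in a Lebesgue integral over a half-line: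
`∫_{2c}^∞ f(y/2) dy = 2 ∫_c^∞ f(u) du` (no measurability needed). [folklore] -/
theorem lintegral_Ioi_comp_half (f : ℝ → ℝ≥0∞) (c : ℝ) :
    ∫⁻ y in Ioi (2 * c), f (y / 2) = 2 * ∫⁻ u in Ioi c, f u := by
  have h2 : (2 : ℝ) ≠ 0 := two_ne_zero
  set e : ℝ ≃ᵐ ℝ := (Homeomorph.mulLeft₀ (2 : ℝ) h2).toMeasurableEquiv with he
  have heu : ∀ u : ℝ, e u = 2 * u := fun u ↦ rfl
  have hmap : Measure.map e volume = ENNReal.ofReal |(2 : ℝ)⁻¹| • volume := by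
    rw [show (e : ℝ → ℝ) = fun x ↦ 2 * x from funext heu]
    exact Real.map_volume_mul_left h2
  set g : ℝ → ℝ≥0∞ := (Ioi (2 * c)).indicator (fun y ↦ f (y / 2)) with hg
  have h1 : ∫⁻ y, g y ∂(Measure.map e volume) = ∫⁻ u, g (e u) := lintegral_map_equiv g e
  have hge : ∀ u : ℝ, g (e u) = (Ioi c).indicator f u := by
    intro u
    rw [heu]
    by_cases hu : c < u
    · rw [hg, Set.indicator_of_mem (show 2 * u ∈ Ioi (2 * c) by
        simp only [Set.mem_Ioi]; linarith), Set.indicator_of_mem (show u ∈ Ioi c from hu)]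
      congr 1
      ring
    · rw [hg, Set.indicator_of_notMem (show 2 * u ∉ Ioi (2 * c) by
        simp only [Set.mem_Ioi]; linarith), Set.indicator_of_notMem (show u ∉ Ioi c from hu)]
  simp_rw [hge] at h1
  rw [hmap, lintegral_smul_measure, hg, lintegral_indicator measurableSet_Ioi,
    lintegral_indicator measurableSet_Ioi, smul_eq_mul] at h1
  rw [← h1, ← mul_assoc, abs_of_pos (by norm_num : (0 : ℝ) < 2⁻¹),
    show (2 : ℝ≥0∞) * ENNReal.ofReal 2⁻¹ = 1 by
      rw [← ENNReal.ofReal_ofNat 2, ← ENNReal.ofReal_mul (by norm_num)]; norm_num, one_mul]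

/-- **The tail**: `∫_2^∞ m(y) y^{s-2} dy ≤ 2 (2s/(ea))ˢ ∫_𝒟 G dμ` (pointwise tail estimate, the
substitution `y = 2u`, and `lintegral_Ioi_one_horocycle_le`). [folklore] -/
theorem lintegral_Ioi_two_horocycle_le (hGc : Continuous G)
    (hGinv : ∀ (A : SL(2, ℤ)) (τ : ℍ), G (A • τ) = G τ) (hG0 : ∀ τ, 0 ≤ G τ)
    (hC : ∀ n, 0 ≤ C n) (hC0 : C 0 = 0) (ha : 0 < a)
    (hs : ∀ y : ℝ, 0 < y → Summable fun n : ℕ ↦ C n * Real.exp (-a * n * y))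
    (hm : ∀ y : ℝ, 0 < y → ∫ x in (0 : ℝ)..1, G (pt x y) =
      y ^ (2 : ℝ) * ∑' n : ℕ, C n * Real.exp (-a * n * y))
    {s : ℝ} (hs0 : 0 < s) :
    ∫⁻ y in Ioi (2 : ℝ), ENNReal.ofReal ((∫ x in (0 : ℝ)..1, G (pt x y)) * y ^ (s - 2)) ≤
      ENNReal.ofReal (2 * (2 * s / (Real.exp 1 * a)) ^ s) *
        ∫⁻ w in ModularGroup.fd, ENNReal.ofReal (G w) := by
  set M : ℝ := (2 * s / (Real.exp 1 * a)) ^ s with hM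
  have hM0 : 0 ≤ M := by positivity
  set f : ℝ → ℝ≥0∞ := fun u ↦ ENNReal.ofReal ((∫ x in (0 : ℝ)..1, G (pt x u)) * ((2 * u) ^ 2)⁻¹)
    with hf
  have h1 : ∫⁻ y in Ioi (2 : ℝ), ENNReal.ofReal ((∫ x in (0 : ℝ)..1, G (pt x y)) * y ^ (s - 2)) ≤
      ∫⁻ y in Ioi (2 : ℝ), ENNReal.ofReal (4 * M) * f (y / 2) := by
    refine setLIntegral_mono' measurableSet_Ioi fun y hy ↦ ?_
    have hy0 : 0 < y := lt_trans two_pos hy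
    rw [hf]
    dsimp only
    rw [show 2 * (y / 2) = y by ring, ← ENNReal.ofReal_mul (by positivity)]
    refine ENNReal.ofReal_le_ofReal ?_
    have := horocycle_mul_rpow_le_tail hC hC0 ha hs hm hs0 hy0
    linarith
  refine h1.trans ?_
  rw [lintegral_const_mul' _ _ ENNReal.ofReal_ne_top, show Ioi (2 : ℝ) = Ioi (2 * 1) by norm_num,
    lintegral_Ioi_comp_half f 1]
  -- `f u = ofReal (1/4) * ofReal (m(u) u^{-2})`
  have hf4 : ∀ u ∈ Ioi (1 : ℝ), f u = ENNReal.ofReal 4⁻¹ *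
      ENNReal.ofReal ((∫ x in (0 : ℝ)..1, G (pt x u)) * (u ^ 2)⁻¹) := by
    intro u hu
    have hu0 : 0 < u := lt_trans one_pos hu
    rw [hf, ← ENNReal.ofReal_mul (by norm_num)]
    field_simp
    ring
  rw [setLIntegral_congr_fun measurableSet_Ioi hf4, lintegral_const_mul' _ _ ENNReal.ofReal_ne_top]
  have hV := lintegral_Ioi_one_horocycle_le hGc hGinv hG0
  calc ENNReal.ofReal (4 * M) * (2 * (ENNReal.ofReal 4⁻¹ *
        ∫⁻ u in Ioi (1 : ℝ), ENNReal.ofReal ((∫ x in (0 : ℝ)..1, G (pt x u)) * (u ^ 2)⁻¹)))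
      = ENNReal.ofReal (2 * M) *
          ∫⁻ u in Ioi (1 : ℝ), ENNReal.ofReal ((∫ x in (0 : ℝ)..1, G (pt x u)) * (u ^ 2)⁻¹) := by
        rw [← mul_assoc, ← mul_assoc, ← ENNReal.ofReal_ofNat 2, ← ENNReal.ofReal_mul (by positivity),
          ← ENNReal.ofReal_mul (by positivity)]
        congr 1
        ring
    _ ≤ ENNReal.ofReal (2 * M) * ∫⁻ w in ModularGroup.fd, ENNReal.ofReal (G w) := by gcongr

/-- **Polynomial moments of the horocycle averages against the mass of one fundamental domain.**
For a `κ = 2` horocycle datum (`G ≥ 0` continuous `SL₂(ℤ)`-invariant with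
`∫₀¹ G(x+iy) dx = y² Σ Cₙ e^{-any}`, `Cₙ ≥ 0`, `C₀ = 0`) and `s ≥ 3/2`:
`∫_0^∞ m(y) y^{s-2} dy ≤ (17 + 4π + 2ˢ + 2(2s/(ea))ˢ) ∫_𝒟 G dμ` — the three ranges `(0,1]`,
`(1,2]`, `(2,∞)`. (By the Rankin–Selberg unfolding the left side is `∫_𝒟 G E(·, s) dμ`; the
point is the uniformity of the constant in the datum, apart from the explicit dependence on `a`.)
[folklore] -/
theorem lintegral_Ioi_horocycle_mul_rpow_le (hGc : Continuous G)
    (hGinv : ∀ (A : SL(2, ℤ)) (τ : ℍ), G (A • τ) = G τ) (hG0 : ∀ τ, 0 ≤ G τ)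
    (hC : ∀ n, 0 ≤ C n) (hC0 : C 0 = 0) (ha : 0 < a)
    (hs : ∀ y : ℝ, 0 < y → Summable fun n : ℕ ↦ C n * Real.exp (-a * n * y))
    (hm : ∀ y : ℝ, 0 < y → ∫ x in (0 : ℝ)..1, G (pt x y) =
      y ^ (2 : ℝ) * ∑' n : ℕ, C n * Real.exp (-a * n * y))
    {s : ℝ} (hs32 : 3 / 2 ≤ s) :
    ∫⁻ y in Ioi (0 : ℝ), ENNReal.ofReal ((∫ x in (0 : ℝ)..1, G (pt x y)) * y ^ (s - 2)) ≤
      ENNReal.ofReal (17 + 4 * π + 2 ^ s + 2 * (2 * s / (Real.exp 1 * a)) ^ s) *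
        ∫⁻ w in ModularGroup.fd, ENNReal.ofReal (G w) := by
  set V := ∫⁻ w in ModularGroup.fd, ENNReal.ofReal (G w) with hV
  set m : ℝ → ℝ := fun y ↦ ∫ x in (0 : ℝ)..1, G (pt x y) with hmdef
  have hs0 : 0 < s := by linarith
  -- the three pieces
  have hA : ∫⁻ y in Ioc (0 : ℝ) 1, ENNReal.ofReal (m y * y ^ (s - 2)) ≤
      ENNReal.ofReal (17 + 4 * π) * V := by
    have hmono : ∫⁻ y in Ioc (0 : ℝ) 1, ENNReal.ofReal (m y * y ^ (s - 2)) ≤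
        ∫⁻ y in Ioc (0 : ℝ) 1, ENNReal.ofReal (m y * y ^ ((3 / 2 : ℝ) - 2)) := by
      refine setLIntegral_mono' measurableSet_Ioc fun y hy ↦ ENNReal.ofReal_le_ofReal ?_
      exact mul_le_mul_of_nonneg_left
        (Real.rpow_le_rpow_of_exponent_ge hy.1 hy.2 (by linarith)) (horocycleAverage_nonneg hG0 y)
    refine hmono.trans ((lintegral_Ioc_zero_one_horocycle_le hGc hGinv hG0
      (by norm_num : (1 : ℝ) < 3 / 2) (by norm_num : (3 / 2 : ℝ) ≤ 2)).trans (le_of_eq ?_))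
    congr 1
    rw [show (2 : ℝ) * ((3 : ℝ) / 2 - 1) = 1 by norm_num, div_one,
      show (16 : ℝ) + 2 * π * (1 + 1) = 16 + 4 * π by ring, ← ENNReal.ofReal_one,
      ← ENNReal.ofReal_add zero_le_one (by positivity)]
    congr 1
    ring
  have hB : ∫⁻ y in Ioc (1 : ℝ) 2, ENNReal.ofReal (m y * y ^ (s - 2)) ≤ ENNReal.ofReal (2 ^ s) * V :=
    lintegral_Ioc_one_two_horocycle_le hGc hGinv hG0 hs0.le
  have hCt : ∫⁻ y in Ioi (2 : ℝ), ENNReal.ofReal (m y * y ^ (s - 2)) ≤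
      ENNReal.ofReal (2 * (2 * s / (Real.exp 1 * a)) ^ s) * V :=
    lintegral_Ioi_two_horocycle_le hGc hGinv hG0 hC hC0 ha hs hm hs0
  -- splitting `(0, ∞) = (0, 1] ∪ (1, 2] ∪ (2, ∞)`
  rw [← Ioc_union_Ioi_eq_Ioi zero_le_one, lintegral_union measurableSet_Ioi Ioc_disjoint_Ioi_same,
    ← Ioc_union_Ioi_eq_Ioi one_le_two, lintegral_union measurableSet_Ioi Ioc_disjoint_Ioi_same]
  have hπ : 0 ≤ 4 * π := by positivity
  have h2s : (0 : ℝ) ≤ 2 ^ s := by positivity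
  have hM : (0 : ℝ) ≤ 2 * (2 * s / (Real.exp 1 * a)) ^ s := by positivity
  calc (∫⁻ y in Ioc (0 : ℝ) 1, ENNReal.ofReal (m y * y ^ (s - 2))) +
        ((∫⁻ y in Ioc (1 : ℝ) 2, ENNReal.ofReal (m y * y ^ (s - 2))) +
          ∫⁻ y in Ioi (2 : ℝ), ENNReal.ofReal (m y * y ^ (s - 2)))
      ≤ ENNReal.ofReal (17 + 4 * π) * V + (ENNReal.ofReal (2 ^ s) * V +
          ENNReal.ofReal (2 * (2 * s / (Real.exp 1 * a)) ^ s) * V) := by gcongr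
    _ = ENNReal.ofReal (17 + 4 * π + 2 ^ s + 2 * (2 * s / (Real.exp 1 * a)) ^ s) * V := by
        rw [ENNReal.ofReal_add (by positivity) hM, ENNReal.ofReal_add (by positivity) h2s]
        ring

end Tail

/-! ### Unfolding `E(·, σ)` for real `σ > 1` in `ℝ≥0∞`, and the uniform bound for `J₀` -/

section JBound

variable {G : ℍ → ℝ} {C : ℕ → ℝ} {a B : ℝ}

/-- `2 |E(w, σ)| = Σ_{(c,d)=1} (Im γ_{c,d} w)^σ` in `ℝ≥0∞`, for real `σ > 1`. [folklore] -/
theorem two_mul_ofReal_norm_eisensteinE (w : ℍ) {σ : ℝ} (hσ : 1 < σ) :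
    2 * ENNReal.ofReal ‖eisensteinE w σ‖ =
      ∑' v : gammaSet 1 1 0, ENNReal.ofReal ((rowRep v • w).im ^ σ) := by
  have hσ' : 1 < (σ : ℂ).re := by simpa using hσ
  obtain ⟨hnorm, -⟩ := norm_eisensteinE_ofReal w hσ
  have hsum : HasSum (fun v : gammaSet 1 1 0 ↦ esTerm (σ : ℂ) v w) (2 * eisensteinE w σ) := by
    have h := (summable_esTerm hσ' w).hasSum
    have e : ∑' v : gammaSet 1 1 0, esTerm (σ : ℂ) v w = 2 * eisensteinE w σ := by
      rw [eisensteinE]; ring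
    rwa [e] at h
  have hre : HasSum (fun v : gammaSet 1 1 0 ↦ (rowRep v • w).im ^ σ) (2 * (eisensteinE w σ).re) := by
    have h2 := Complex.hasSum_re hsum
    have e2 : (2 * eisensteinE w (σ : ℂ)).re = 2 * (eisensteinE w σ).re := by simp
    rw [e2] at h2
    refine h2.congr_fun fun v ↦ ?_
    show (rowRep v • w).im ^ σ = (esTerm (σ : ℂ) v w).re
    rw [← im_rowRep_cpow_eq_esTerm, ← Complex.ofReal_cpow (UpperHalfPlane.im_pos _).le,
      Complex.ofReal_re]
  rw [hnorm, ← ENNReal.ofReal_ofNat 2, ← ENNReal.ofReal_mul (by norm_num), ← hre.tsum_eq,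
    ENNReal.ofReal_tsum_of_nonneg (fun v ↦ Real.rpow_nonneg (UpperHalfPlane.im_pos _).le _)
      hre.summable]

/-- **Unfolding `E(·, σ)` against `G` for real `σ > 1`, in `ℝ≥0∞`** (no integrability needed):
`∫_𝒟 G |E(·, σ)| dμ = ∫_0^∞ m(y) y^{σ-2} dy`, `m(y) = ∫₀¹ G(x+iy) dx`. [cite: Rankin1939, §4] -/
theorem lintegral_fd_mul_norm_eisensteinE_eq (hGc : Continuous G)
    (hGinv : ∀ (A : SL(2, ℤ)) (τ : ℍ), G (A • τ) = G τ) (hG0 : ∀ τ, 0 ≤ G τ) {σ : ℝ}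
    (hσ : 1 < σ) :
    ∫⁻ w in ModularGroup.fd, ENNReal.ofReal (G w) * ENNReal.ofReal ‖eisensteinE w σ‖ =
      ∫⁻ y in Ioi (0 : ℝ), ENNReal.ofReal ((∫ x in (0 : ℝ)..1, G (pt x y)) * y ^ (σ - 2)) := by
  set Ψ : ℍ → ℝ≥0∞ := fun z ↦ ENNReal.ofReal (z.im ^ σ) with hΨdef
  have hΦm := measurable_ofReal_comp hGc
  have hΨm : Measurable Ψ :=
    ENNReal.measurable_ofReal.comp (UpperHalfPlane.continuous_im.measurable.pow_const σ)
  have hΨ : ∀ (n : ℤ) (w : ℍ), Ψ ((n : ℝ) +ᵥ w) = Ψ w := by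
    intro n w
    rw [hΨdef]
    dsimp only
    rw [UpperHalfPlane.vadd_im]
  have h := setLIntegral_fd_mul_tsum_coset hΦm hΨm (ofReal_comp_smul_eq hGinv) hΨ
  have h2 : 2 * ∫⁻ w in ModularGroup.fd, ENNReal.ofReal (G w) * ENNReal.ofReal ‖eisensteinE w σ‖ =
      ∫⁻ w in ModularGroup.fd, ENNReal.ofReal (G w) * ∑' v : gammaSet 1 1 0, Ψ (rowRep v • w) := by
    rw [← lintegral_const_mul' _ _ ENNReal.ofNat_ne_top]
    refine setLIntegral_congr_fun ModularGroup.isClosed_fd.measurableSet fun w _ ↦ ?_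
    rw [← mul_assoc, mul_comm (2 : ℝ≥0∞), mul_assoc, two_mul_ofReal_norm_eisensteinE w hσ]
  have h3 : ∫⁻ w in stripFD, Ψ w * ENNReal.ofReal (G w) =
      ∫⁻ y in Ioi (0 : ℝ), ENNReal.ofReal ((∫ x in (0 : ℝ)..1, G (pt x y)) * y ^ (σ - 2)) := by
    set Fi : ℍ → ℝ≥0∞ := fun w ↦ Ψ w * ENNReal.ofReal (G w) with hFi
    have hFm : Measurable Fi := hΨm.mul hΦm
    change ∫⁻ w in stripFD, Fi w = _
    rw [setLIntegral_stripFD_eq Fi hFm]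
    refine setLIntegral_congr_fun measurableSet_Ioi fun y hy ↦ ?_
    have hy0 : (0 : ℝ) < y := hy
    have hin : ∀ x : ℝ, Fi (pt x y) = ENNReal.ofReal (y ^ σ) * ENNReal.ofReal (G (pt x y)) := by
      intro x
      rw [hFi, hΨdef]
      dsimp only
      rw [pt_im hy0]
    simp_rw [hin]
    have hmx : Measurable (fun x : ℝ ↦ ENNReal.ofReal (G (pt x y))) :=
      hΦm.comp (continuous_pt hy0).measurable
    rw [lintegral_const_mul _ hmx, lintegral_Ico_ofReal_eq hGc hG0 hy0,
      ← ENNReal.ofReal_mul (Real.rpow_nonneg hy0.le _),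
      ← ENNReal.ofReal_mul (mul_nonneg (Real.rpow_nonneg hy0.le _) (horocycleAverage_nonneg hG0 y))]
    congr 1
    have : y ^ (σ - 2) = y ^ σ * (y ^ 2)⁻¹ := by
      rw [Real.rpow_sub hy0, Real.rpow_two, div_eq_mul_inv]
    rw [this]
    ring
  have h4 : 2 * ∫⁻ w in ModularGroup.fd, ENNReal.ofReal (G w) * ENNReal.ofReal ‖eisensteinE w σ‖ =
      2 * ∫⁻ y in Ioi (0 : ℝ), ENNReal.ofReal ((∫ x in (0 : ℝ)..1, G (pt x y)) * y ^ (σ - 2)) := by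
    rw [h2, h, h3]
  exact (ENNReal.mul_right_inj two_ne_zero ENNReal.ofNat_ne_top).mp h4

/-- `∫_𝒟 G |E(·, σ)| dμ ≤ (17 + 4π + 2^σ + 2(2σ/(ea))^σ) ∫_𝒟 G dμ` for real `σ ≥ 3/2` and a
`κ = 2` horocycle datum. [folklore] -/
theorem lintegral_fd_mul_norm_eisensteinE_le (hGc : Continuous G)
    (hGinv : ∀ (A : SL(2, ℤ)) (τ : ℍ), G (A • τ) = G τ) (hG0 : ∀ τ, 0 ≤ G τ)
    (hC : ∀ n, 0 ≤ C n) (hC0 : C 0 = 0) (ha : 0 < a)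
    (hs : ∀ y : ℝ, 0 < y → Summable fun n : ℕ ↦ C n * Real.exp (-a * n * y))
    (hm : ∀ y : ℝ, 0 < y → ∫ x in (0 : ℝ)..1, G (pt x y) =
      y ^ (2 : ℝ) * ∑' n : ℕ, C n * Real.exp (-a * n * y))
    {σ : ℝ} (hσ : 3 / 2 ≤ σ) :
    ∫⁻ w in ModularGroup.fd, ENNReal.ofReal (G w) * ENNReal.ofReal ‖eisensteinE w σ‖ ≤
      ENNReal.ofReal (17 + 4 * π + 2 ^ σ + 2 * (2 * σ / (Real.exp 1 * a)) ^ σ) *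
        ∫⁻ w in ModularGroup.fd, ENNReal.ofReal (G w) := by
  rw [lintegral_fd_mul_norm_eisensteinE_eq hGc hGinv hG0 (by linarith)]
  exact lintegral_Ioi_horocycle_mul_rpow_le hGc hGinv hG0 hC hC0 ha hs hm hσ

/-- The constant `P_σ(a) = 17 + 4π + 2^σ + 2 (2σ/(ea))^σ` of `lintegral_fd_mul_norm_eisensteinE_le`
is at most `(17 + 4π + 2^σ + 2(2σ/e)^σ)(1 + a⁻¹)⁴` for `0 < σ ≤ 4`. [folklore] -/
theorem const_le_mul_pow_four {σ a : ℝ} (hσ0 : 0 < σ) (hσ4 : σ ≤ 4) (ha : 0 < a) :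
    17 + 4 * π + 2 ^ σ + 2 * (2 * σ / (Real.exp 1 * a)) ^ σ ≤
      (17 + 4 * π + 2 ^ σ + 2 * (2 * σ / Real.exp 1) ^ σ) * (1 + a⁻¹) ^ 4 := by
  have h1 : (1 : ℝ) ≤ 1 + a⁻¹ := by
    have : 0 < a⁻¹ := inv_pos.mpr ha
    linarith
  have h14 : (1 : ℝ) ≤ (1 + a⁻¹) ^ 4 := one_le_pow₀ h1
  have hq : (2 * σ / (Real.exp 1 * a)) ^ σ = (2 * σ / Real.exp 1) ^ σ * a⁻¹ ^ σ := by
    rw [show 2 * σ / (Real.exp 1 * a) = (2 * σ / Real.exp 1) * a⁻¹ by field_simp,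
      Real.mul_rpow (by positivity) (by positivity)]
  have hainv : a⁻¹ ^ σ ≤ (1 + a⁻¹) ^ 4 := by
    calc a⁻¹ ^ σ ≤ (1 + a⁻¹) ^ σ :=
          Real.rpow_le_rpow (by positivity) (by linarith) hσ0.le
      _ ≤ (1 + a⁻¹) ^ (4 : ℝ) := Real.rpow_le_rpow_of_exponent_le h1 hσ4
      _ = (1 + a⁻¹) ^ 4 := by norm_num
  have hπ : 0 < π := Real.pi_pos
  have hA : (0 : ℝ) ≤ 17 + 4 * π + 2 ^ σ := by positivity
  have hBq : (0 : ℝ) ≤ (2 * σ / Real.exp 1) ^ σ := by positivity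
  rw [hq]
  nlinarith [mul_le_mul_of_nonneg_left hainv hBq, mul_le_mul_of_nonneg_left h14 hA]

/-- **The uniform a priori bound for `J₀` (explicit form).** For a `κ = 2` horocycle datum and
`-1/2 ≤ Re s ≤ 7/2`:
`‖∫_𝒟 G E₀*(·, s) dμ‖ ≤ (c₁ P_{3/2}(a) + c₂ P_{7/2}(a) + c₃) ∫_𝒟 G dμ` with the absolute constants
`c₁ = |π^{-3/2} Γ(3/2) ζ(3)|`, `c₂ = |π^{-7/2} Γ(7/2) ζ(7)|`, `c₃ = (2/3 + 2/7)/2` of the majorant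
`norm_completedEisenstein₀_le` and `P_σ(a) = 17 + 4π + 2^σ + 2(2σ/(ea))^σ` — in particular the bound
depends on the datum only through `a` and `∫_𝒟 G` (not on `sup G`). [cite: Rankin1939, §4.4] -/
theorem norm_J₀_le_explicit (hGc : Continuous G)
    (hGinv : ∀ (A : SL(2, ℤ)) (τ : ℍ), G (A • τ) = G τ) (hG0 : ∀ τ, 0 ≤ G τ)
    (hGB : ∀ τ, G τ ≤ B) (hC : ∀ n, 0 ≤ C n) (hC0 : C 0 = 0) (ha : 0 < a)
    (hs : ∀ y : ℝ, 0 < y → Summable fun n : ℕ ↦ C n * Real.exp (-a * n * y))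
    (hm : ∀ y : ℝ, 0 < y → ∫ x in (0 : ℝ)..1, G (pt x y) =
      y ^ (2 : ℝ) * ∑' n : ℕ, C n * Real.exp (-a * n * y))
    {s : ℂ} (hsa : -1 / 2 ≤ s.re) (hsb : s.re ≤ 7 / 2) :
    ‖∫ w in ModularGroup.fd, (G w : ℂ) * completedEisenstein₀ w s‖ ≤
      (‖(π : ℂ) ^ (-((3 / 2 : ℝ) : ℂ)) * Complex.Gamma (3 / 2 : ℝ) * riemannZeta (2 * (3 / 2 : ℝ))‖ *
          (17 + 4 * π + 2 ^ (3 / 2 : ℝ) + 2 * (2 * (3 / 2 : ℝ) / (Real.exp 1 * a)) ^ (3 / 2 : ℝ)) +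
        ‖(π : ℂ) ^ (-((7 / 2 : ℝ) : ℂ)) * Complex.Gamma (7 / 2 : ℝ) * riemannZeta (2 * (7 / 2 : ℝ))‖ *
          (17 + 4 * π + 2 ^ (7 / 2 : ℝ) + 2 * (2 * (7 / 2 : ℝ) / (Real.exp 1 * a)) ^ (7 / 2 : ℝ)) +
        (1 / (3 / 2 : ℝ) + 1 / (7 / 2 : ℝ)) / 2) *
      ∫ w in ModularGroup.fd, G w := by
  have hκ : (0 : ℝ) ≤ 2 := by norm_num
  set c₁ : ℝ := ‖(π : ℂ) ^ (-((3 / 2 : ℝ) : ℂ)) * Complex.Gamma (3 / 2 : ℝ) *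
    riemannZeta (2 * (3 / 2 : ℝ))‖ with hc₁
  set c₂ : ℝ := ‖(π : ℂ) ^ (-((7 / 2 : ℝ) : ℂ)) * Complex.Gamma (7 / 2 : ℝ) *
    riemannZeta (2 * (7 / 2 : ℝ))‖ with hc₂
  set c₃ : ℝ := (1 / (3 / 2 : ℝ) + 1 / (7 / 2 : ℝ)) / 2 with hc₃
  set P₁ : ℝ := 17 + 4 * π + 2 ^ (3 / 2 : ℝ) + 2 * (2 * (3 / 2 : ℝ) / (Real.exp 1 * a)) ^ (3 / 2 : ℝ)
    with hP₁
  set P₂ : ℝ := 17 + 4 * π + 2 ^ (7 / 2 : ℝ) + 2 * (2 * (7 / 2 : ℝ) / (Real.exp 1 * a)) ^ (7 / 2 : ℝ)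
    with hP₂
  have hc₁0 : 0 ≤ c₁ := norm_nonneg _
  have hc₂0 : 0 ≤ c₂ := norm_nonneg _
  have hc₃0 : 0 ≤ c₃ := by rw [hc₃]; norm_num
  have hP₁0 : 0 ≤ P₁ := by rw [hP₁]; positivity
  have hP₂0 : 0 ≤ P₂ := by rw [hP₂]; positivity
  -- the majorant of the tree (`norm_J₀_le` with `σa = -1/2`, `σb = 7/2`)
  set bound : ℍ → ℝ := fun w ↦ G w * (c₁ * ‖eisensteinE w (3 / 2 : ℝ)‖ +
    c₂ * ‖eisensteinE w (7 / 2 : ℝ)‖ + c₃) with hbound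
  have hbi : Integrable bound (volume.restrict ModularGroup.fd) :=
    integrableOn_fd_majorant hGc hGinv hG0 hGB hC hC0 ha hκ hs hm (by norm_num) (by norm_num) c₁ c₂ c₃
  have hb0 : ∀ w, 0 ≤ bound w := fun w ↦ mul_nonneg (hG0 w) (by positivity)
  have h32 : (1 - (-1 / 2 : ℝ) : ℝ) = 3 / 2 := by norm_num
  have hJle : ‖∫ w in ModularGroup.fd, (G w : ℂ) * completedEisenstein₀ w s‖ ≤
      ∫ w in ModularGroup.fd, bound w := by
    refine (norm_integral_le_integral_norm _).trans (integral_mono_of_nonneg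
      (ae_of_all _ fun w ↦ norm_nonneg _) hbi (ae_of_all _ fun w ↦ ?_))
    have hE := norm_completedEisenstein₀_le w (σa := -1 / 2) (σb := 7 / 2) (by norm_num) (by norm_num)
      hsa hsb
    rw [h32] at hE
    dsimp only
    rw [norm_mul, Complex.norm_real, Real.norm_of_nonneg (hG0 w)]
    exact mul_le_mul_of_nonneg_left hE (hG0 w)
  refine hJle.trans ?_
  -- pass to Lebesgue integrals
  have hbound' : ∀ w, bound w = G w * (c₁ * ‖eisensteinE w (3 / 2 : ℝ)‖ +
      c₂ * ‖eisensteinE w (7 / 2 : ℝ)‖ + c₃) := fun w ↦ rfl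
  set V : ℝ≥0∞ := ∫⁻ w in ModularGroup.fd, ENNReal.ofReal (G w) with hV
  have hΦm := measurable_ofReal_comp hGc
  have hE1m : Measurable fun w : ℍ ↦ ENNReal.ofReal ‖eisensteinE w (3 / 2 : ℝ)‖ :=
    ENNReal.measurable_ofReal.comp (continuous_eisensteinE (by simp; norm_num)).norm.measurable
  have hE2m : Measurable fun w : ℍ ↦ ENNReal.ofReal ‖eisensteinE w (7 / 2 : ℝ)‖ :=
    ENNReal.measurable_ofReal.comp (continuous_eisensteinE (by simp; norm_num)).norm.measurable
  have hΦE1m : Measurable (fun w : ℍ ↦ ENNReal.ofReal (G w) * ENNReal.ofReal ‖eisensteinE w (3 / 2 : ℝ)‖) :=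
    hΦm.mul hE1m
  have hΦE2m : Measurable (fun w : ℍ ↦ ENNReal.ofReal (G w) * ENNReal.ofReal ‖eisensteinE w (7 / 2 : ℝ)‖) :=
    hΦm.mul hE2m
  have hm1 : Measurable (fun w : ℍ ↦ ENNReal.ofReal c₁ *
      (ENNReal.ofReal (G w) * ENNReal.ofReal ‖eisensteinE w (3 / 2 : ℝ)‖)) := hΦE1m.const_mul _
  have hm2 : Measurable (fun w : ℍ ↦ ENNReal.ofReal c₂ *
      (ENNReal.ofReal (G w) * ENNReal.ofReal ‖eisensteinE w (7 / 2 : ℝ)‖)) := hΦE2m.const_mul _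
  have hm12 : Measurable (fun w : ℍ ↦ ENNReal.ofReal c₁ *
      (ENNReal.ofReal (G w) * ENNReal.ofReal ‖eisensteinE w (3 / 2 : ℝ)‖) + ENNReal.ofReal c₂ *
      (ENNReal.ofReal (G w) * ENNReal.ofReal ‖eisensteinE w (7 / 2 : ℝ)‖)) := hm1.add hm2
  have hlin : ∫⁻ w in ModularGroup.fd, ENNReal.ofReal (bound w) =
      ENNReal.ofReal c₁ * (∫⁻ w in ModularGroup.fd, ENNReal.ofReal (G w) *
          ENNReal.ofReal ‖eisensteinE w (3 / 2 : ℝ)‖) +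
        ENNReal.ofReal c₂ * (∫⁻ w in ModularGroup.fd, ENNReal.ofReal (G w) *
          ENNReal.ofReal ‖eisensteinE w (7 / 2 : ℝ)‖) +
        ENNReal.ofReal c₃ * V := by
    have hpt : ∀ w, ENNReal.ofReal (bound w) =
        ENNReal.ofReal c₁ * (ENNReal.ofReal (G w) * ENNReal.ofReal ‖eisensteinE w (3 / 2 : ℝ)‖) +
        ENNReal.ofReal c₂ * (ENNReal.ofReal (G w) * ENNReal.ofReal ‖eisensteinE w (7 / 2 : ℝ)‖) +
        ENNReal.ofReal c₃ * ENNReal.ofReal (G w) := by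
      intro w
      have ht1 : 0 ≤ c₁ * (G w * ‖eisensteinE w (3 / 2 : ℝ)‖) :=
        mul_nonneg hc₁0 (mul_nonneg (hG0 w) (norm_nonneg _))
      have ht2 : 0 ≤ c₂ * (G w * ‖eisensteinE w (7 / 2 : ℝ)‖) :=
        mul_nonneg hc₂0 (mul_nonneg (hG0 w) (norm_nonneg _))
      have ht3 : 0 ≤ c₃ * G w := mul_nonneg hc₃0 (hG0 w)
      have e : bound w = c₁ * (G w * ‖eisensteinE w (3 / 2 : ℝ)‖) +
          c₂ * (G w * ‖eisensteinE w (7 / 2 : ℝ)‖) + c₃ * G w := by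
        rw [hbound' w]; ring
      rw [e, ENNReal.ofReal_add (add_nonneg ht1 ht2) ht3, ENNReal.ofReal_add ht1 ht2,
        ENNReal.ofReal_mul hc₁0, ENNReal.ofReal_mul hc₂0, ENNReal.ofReal_mul hc₃0,
        ENNReal.ofReal_mul (hG0 w), ENNReal.ofReal_mul (hG0 w)]
    simp_rw [hpt]
    rw [lintegral_add_left hm12, lintegral_add_left hm1, lintegral_const_mul _ hΦE1m,
      lintegral_const_mul _ hΦE2m, lintegral_const_mul _ hΦm]
  have hle : ∫⁻ w in ModularGroup.fd, ENNReal.ofReal (bound w) ≤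
      ENNReal.ofReal (c₁ * P₁ + c₂ * P₂ + c₃) * V := by
    rw [hlin]
    have h1 : ∫⁻ w in ModularGroup.fd, ENNReal.ofReal (G w) * ENNReal.ofReal ‖eisensteinE w (3 / 2 : ℝ)‖ ≤
        ENNReal.ofReal P₁ * V :=
      lintegral_fd_mul_norm_eisensteinE_le hGc hGinv hG0 hC hC0 ha hs hm (by norm_num : (3 / 2 : ℝ) ≤ 3 / 2)
    have h2 : ∫⁻ w in ModularGroup.fd, ENNReal.ofReal (G w) * ENNReal.ofReal ‖eisensteinE w (7 / 2 : ℝ)‖ ≤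
        ENNReal.ofReal P₂ * V :=
      lintegral_fd_mul_norm_eisensteinE_le hGc hGinv hG0 hC hC0 ha hs hm (by norm_num : (3 / 2 : ℝ) ≤ 7 / 2)
    calc ENNReal.ofReal c₁ * (∫⁻ w in ModularGroup.fd, ENNReal.ofReal (G w) *
            ENNReal.ofReal ‖eisensteinE w (3 / 2 : ℝ)‖) +
          ENNReal.ofReal c₂ * (∫⁻ w in ModularGroup.fd, ENNReal.ofReal (G w) *
            ENNReal.ofReal ‖eisensteinE w (7 / 2 : ℝ)‖) +
          ENNReal.ofReal c₃ * V
        ≤ ENNReal.ofReal c₁ * (ENNReal.ofReal P₁ * V) + ENNReal.ofReal c₂ * (ENNReal.ofReal P₂ * V) +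
          ENNReal.ofReal c₃ * V := by gcongr
      _ = ENNReal.ofReal (c₁ * P₁ + c₂ * P₂ + c₃) * V := by
          rw [ENNReal.ofReal_add (add_nonneg (mul_nonneg hc₁0 hP₁0) (mul_nonneg hc₂0 hP₂0)) hc₃0,
            ENNReal.ofReal_add (mul_nonneg hc₁0 hP₁0) (mul_nonneg hc₂0 hP₂0),
            ENNReal.ofReal_mul hc₁0, ENNReal.ofReal_mul hc₂0]
          ring
  -- finiteness of `V`
  have hVlt : V < ⊤ := by
    have hB0 : 0 ≤ B := (hG0 UpperHalfPlane.I).trans (hGB _)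
    calc V ≤ ∫⁻ _ in ModularGroup.fd, ENNReal.ofReal B :=
          lintegral_mono fun w ↦ ENNReal.ofReal_le_ofReal (hGB w)
      _ = ENNReal.ofReal B * volume ModularGroup.fd := by rw [lintegral_const, Measure.restrict_apply_univ]
      _ < ⊤ := ENNReal.mul_lt_top ENNReal.ofReal_lt_top volume_modular_fd_lt_top
  -- back to Bochner integrals
  have hGint : IntegrableOn G ModularGroup.fd := by
    refine ⟨hGc.aestronglyMeasurable.restrict, ?_⟩
    rw [HasFiniteIntegral]
    calc ∫⁻ w in ModularGroup.fd, ‖G w‖ₑ = V := by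
          refine lintegral_congr fun w ↦ ?_
          rw [← ofReal_norm, Real.norm_of_nonneg (hG0 w)]
      _ < ⊤ := hVlt
  have hVeq : ∫ w in ModularGroup.fd, G w = V.toReal := by
    rw [integral_eq_lintegral_of_nonneg_ae (ae_of_all _ hG0) hGc.aestronglyMeasurable.restrict]
  have hbeq : ∫ w in ModularGroup.fd, bound w = (∫⁻ w in ModularGroup.fd, ENNReal.ofReal (bound w)).toReal := by
    rw [integral_eq_lintegral_of_nonneg_ae (ae_of_all _ hb0) hbi.aestronglyMeasurable]
  rw [hbeq, hVeq]
  have hfin : ENNReal.ofReal (c₁ * P₁ + c₂ * P₂ + c₃) * V ≠ ⊤ :=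
    ENNReal.mul_ne_top ENNReal.ofReal_ne_top hVlt.ne
  calc (∫⁻ w in ModularGroup.fd, ENNReal.ofReal (bound w)).toReal
      ≤ (ENNReal.ofReal (c₁ * P₁ + c₂ * P₂ + c₃) * V).toReal := ENNReal.toReal_mono hfin hle
    _ = (c₁ * P₁ + c₂ * P₂ + c₃) * V.toReal := by
        rw [ENNReal.toReal_mul, ENNReal.toReal_ofReal (by positivity)]

/-- **The uniform a priori bound for `J₀`, packaged.** There is an absolute constant `Q > 0` such
that for every `κ = 2` horocycle datum `(G, C, a, B)` and every `s` with `-1/2 ≤ Re s ≤ 7/2`: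
`‖∫_𝒟 G E₀*(·, s) dμ‖ ≤ Q (1 + a⁻¹)⁴ ∫_𝒟 G dμ`. (For the trace `G_f` of a cusp form
`f ∈ S₂(Γ₀(N))` one has `a = 4π/N`, so the bound is polynomial in the level and linear in the
Petersson norm — the input of Siegel-type arguments in the level aspect.)
[cite: Rankin1939, §4.4] -/
theorem exists_norm_J₀_le_uniform :
    ∃ Q : ℝ, 0 < Q ∧ ∀ ⦃G : ℍ → ℝ⦄ ⦃C : ℕ → ℝ⦄ ⦃a B : ℝ⦄, Continuous G →
      (∀ (A : SL(2, ℤ)) (τ : ℍ), G (A • τ) = G τ) → (∀ τ, 0 ≤ G τ) → (∀ τ, G τ ≤ B) →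
      (∀ n, 0 ≤ C n) → C 0 = 0 → 0 < a →
      (∀ y : ℝ, 0 < y → Summable fun n : ℕ ↦ C n * Real.exp (-a * n * y)) →
      (∀ y : ℝ, 0 < y → ∫ x in (0 : ℝ)..1, G (pt x y) =
        y ^ (2 : ℝ) * ∑' n : ℕ, C n * Real.exp (-a * n * y)) →
      ∀ ⦃s : ℂ⦄, -1 / 2 ≤ s.re → s.re ≤ 7 / 2 →
        ‖∫ w in ModularGroup.fd, (G w : ℂ) * completedEisenstein₀ w s‖ ≤
          Q * (1 + a⁻¹) ^ 4 * ∫ w in ModularGroup.fd, G w := by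
  set c₁ : ℝ := ‖(π : ℂ) ^ (-((3 / 2 : ℝ) : ℂ)) * Complex.Gamma (3 / 2 : ℝ) *
    riemannZeta (2 * (3 / 2 : ℝ))‖ with hc₁
  set c₂ : ℝ := ‖(π : ℂ) ^ (-((7 / 2 : ℝ) : ℂ)) * Complex.Gamma (7 / 2 : ℝ) *
    riemannZeta (2 * (7 / 2 : ℝ))‖ with hc₂
  set c₃ : ℝ := (1 / (3 / 2 : ℝ) + 1 / (7 / 2 : ℝ)) / 2 with hc₃
  set Q₁ : ℝ := 17 + 4 * π + 2 ^ (3 / 2 : ℝ) + 2 * (2 * (3 / 2 : ℝ) / Real.exp 1) ^ (3 / 2 : ℝ) with hQ₁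
  set Q₂ : ℝ := 17 + 4 * π + 2 ^ (7 / 2 : ℝ) + 2 * (2 * (7 / 2 : ℝ) / Real.exp 1) ^ (7 / 2 : ℝ) with hQ₂
  have hc₁0 : 0 ≤ c₁ := norm_nonneg _
  have hc₂0 : 0 ≤ c₂ := norm_nonneg _
  have hc₃0 : 0 < c₃ := by rw [hc₃]; norm_num
  have hQ₁0 : 0 ≤ Q₁ := by rw [hQ₁]; positivity
  have hQ₂0 : 0 ≤ Q₂ := by rw [hQ₂]; positivity
  refine ⟨c₁ * Q₁ + c₂ * Q₂ + c₃, by positivity, ?_⟩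
  intro G C a B hGc hGinv hG0 hGB hC hC0 ha hs hm s hsa hsb
  have h := norm_J₀_le_explicit hGc hGinv hG0 hGB hC hC0 ha hs hm hsa hsb
  refine h.trans ?_
  have hV0 : 0 ≤ ∫ w in ModularGroup.fd, G w := setIntegral_nonneg ModularGroup.isClosed_fd.measurableSet
    fun w _ ↦ hG0 w
  refine mul_le_mul_of_nonneg_right ?_ hV0
  have h1 := const_le_mul_pow_four (σ := 3 / 2) (by norm_num) (by norm_num) ha
  have h2 := const_le_mul_pow_four (σ := 7 / 2) (by norm_num) (by norm_num) ha
  have h14 : (1 : ℝ) ≤ (1 + a⁻¹) ^ 4 := one_le_pow₀ (by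
    have : 0 < a⁻¹ := inv_pos.mpr ha
    linarith)
  calc c₁ * (17 + 4 * π + 2 ^ (3 / 2 : ℝ) + 2 * (2 * (3 / 2 : ℝ) / (Real.exp 1 * a)) ^ (3 / 2 : ℝ)) +
        c₂ * (17 + 4 * π + 2 ^ (7 / 2 : ℝ) + 2 * (2 * (7 / 2 : ℝ) / (Real.exp 1 * a)) ^ (7 / 2 : ℝ)) + c₃
      ≤ c₁ * (Q₁ * (1 + a⁻¹) ^ 4) + c₂ * (Q₂ * (1 + a⁻¹) ^ 4) + c₃ * (1 + a⁻¹) ^ 4 := by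
        have h3 : c₃ ≤ c₃ * (1 + a⁻¹) ^ 4 := le_mul_of_one_le_right hc₃0.le h14
        gcongr
    _ = (c₁ * Q₁ + c₂ * Q₂ + c₃) * (1 + a⁻¹) ^ 4 := by ring

end JBound

end Literature.NumberTheory.Automorphic
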